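import Summits.CriticalPhenomena.SAWScalingLimit.Theorems.SAWDevelopingMapHexTransferPortTransfer
import Summits.CriticalPhenomena.SAWScalingLimit.Theorems.SAWDevelopingMapHexTransferPortDictionary
import Summits.CriticalPhenomena.SAWScalingLimit.Theorems.SAWCompassLatticeCompassSLEYbCriterion
import Summits.CriticalPhenomena.SAWScalingLimit.Theorems.SAWCompassLatticeCompassSLEYbAvoidancePassage
import Summits.CriticalPhenomena.SAWScalingLimit.Theorems.SAWCompassLatticeCompassSLEYbTightOfTraversalBound
import Summits.CriticalPhenomena.SAWScalingLimit.Theorems.SAWCompassLatticeCompassSLEYbSubseqLimitChordal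
import Summits.CriticalPhenomena.SAWScalingLimit.Theorems.SAWLoopFugacityFlowAvoidanceDeterminesLaw
import Summits.CriticalPhenomena.SAWScalingLimit.Theorems.SAWLoopFugacityFlowSLECarrier
import Summits.CriticalPhenomena.SAWScalingLimit.Theorems.SAWSteinDefectSLEAvoidanceValue
import Summits.CriticalPhenomena.SAWScalingLimit.Theorems.SAWLoopFugacityFlowSimpleSubseqLimitsStubRangeIsArcBoundary
import Literature.Probability.RandomPlanarGeometry.SLEExistenceNeEightHolds
import Literature.Probability.RandomPlanarGeometry.CaratheodoryHalfPlaneProofs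
import Literature.Probability.RandomPlanarGeometry.RestrictionHullsRiemannProofs
import Literature.Probability.RandomPlanarGeometry.RestrictionHullsProofs
import Literature.Probability.RandomPlanarGeometry.HullSubdomainPullback
import Literature.Probability.RandomPlanarGeometry.JordanDomainProofs
import Literature.Probability.RandomPlanarGeometry.CurveTightness

/-!
# `CompassSLE` reduced to three named open inputs (crux stmt-CriticalPhenomena-6965, line `registered`/`birth`, lead c1)

The sorry-free content of the registered skeleton `Cruxes/CompassSLE/Lines/birth.lean` (v4), as ONE
importable theorem: the crux `SAWCompassLattice.CompassSLE` (equivalently `YBSquareSLE`, stmt-6967 —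
`compassSLE_iff_ybSquareSLE`) follows from

* **T1** — the Aizenman–Burchard multi-traversal bound for the curve laws of Glazman–Manolescu's critical
  `π/2` Yang–Baxter walk (shape of the items `SAWLeftRightFKG.SAWTraversalBound` / `HexTraversalBound`;
  with the shell-dependent threshold it is EQUIVALENT to tightness along the mesh);
* **I1** — the Lawler–Schramm–Werner `5/8` restriction law for that walk (`π/2` twin of items
  stmt-7147 `HexRestrictionLaw` / stmt-4981 `AvoidanceLimit`; the conformal content);
* **I2b** — simplicity of the probability subsequential limit laws (`π/2` twin of the hard core of
  stmt-7148 / stmt-4982),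

through the LANDED pieces: T2 `stub_ybTightOfTraversalBound` (p144902), C `stub_ybCriterion` (p143596),
I2a `stub_ybSubseqLimitChordal` (p144900), I3 `stub_ybAvoidancePassage` (p144241), the port transfer
`Cruxes.HexTransfer.Sketch.stub_portTransfer` + `stub_portDictionary`, and the PROVED tree theorems of the
LSW restriction programme (`exists_isSLECurve_eightThirds`, `SLECarrier_proof` stmt-4985,
`MarkedDomain.exists_isChordalUniformizing_holds`, `IsingBoundaryRatio.Negative.isHullSubdomain_of_conds`,
`IsStarHull.pullbackHull` + `JordanDomain.isSimplyConnected_holds`, `IsStarHull.exists_isRestrictionMap`,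
`IsStarHull.exists_hasRestrictionDeriv_holds`, `SLEAvoidanceValue_pullbackHull_proof` stmt-4986,
`ArcRangeBoundary.stub_rangeIsArc_boundary`, `AvoidanceDeterminesLaw_proof` stmt-1373).

Registered on the crux item as the sub-goal stub `compassSLE_of_traversalBound_restrictionLaw_simpleLimits`.
All three hypotheses are open problems (pieces of Duminil-Copin–Smirnov 2012 Conjecture 1 transported to
GM's `π/2` walk); each is a consequence of the crux, so the reduction loses nothing.
-/

noncomputable section

namespace Summit.CriticalPhenomena.SAWScalingLimit.Theorems.SAWCompassLatticeCompassSLE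

open MeasureTheory Filter Topology Set
open scoped NNReal ENNReal
open UpperHalfPlane (upperHalfPlaneSet)
open Literature.Probability.RandomPlanarGeometry
open Literature.Probability.RandomPlanarGeometry.SAW.YangBaxter
open Summit.CriticalPhenomena.SAWScalingLimit.Theses

/-- **Identification of the subsequential limits of GM's `π/2` walk from the `5/8` restriction law (I1)
and simplicity of the limits (I2b)** — the Lawler–Schramm–Werner restriction programme, all other steps
being landed theorems (I2a chordality, I3 avoidance passage, the SLE(8/3) side). -/
theorem ybSubseqIdentification_of_restrictionLaw_of_simple
    (hR :
      ∀ (D D' : DobrushinDomain) (a b : ℝ → MidEdge),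
        IsYBEndpointApprox (fun (_ : ℤ) => Real.pi / 2) D a b →
        D'.carrier ⊆ D.carrier → D'.pt 0 = D.pt 0 → D'.pt 1 = D.pt 1 →
        (∃ ε : ℝ, 0 < ε ∧ D'.carrier ∩ Metric.ball (D.pt 0) ε = D.carrier ∩ Metric.ball (D.pt 0) ε ∧
          D'.carrier ∩ Metric.ball (D.pt 1) ε = D.carrier ∩ Metric.ball (D.pt 1) ε) →
        ∀ (φ : ConformalEquiv upperHalfPlaneSet D.carrier), D.IsChordalUniformizing φ →
        ∀ (Φ : ConformalEquiv (upperHalfPlaneSet \ φ.pullbackHull D') upperHalfPlaneSet) (d : ℝ),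
          IsRestrictionMap (φ.pullbackHull D') Φ → HasRestrictionDeriv (φ.pullbackHull D') Φ d →
          Tendsto (fun δ => ((ybLaw (fun (_ : ℤ) => Real.pi / 2) D.carrier δ 1 (a δ) (b δ)).map
              (fun γ => γ.curve (fun (_ : ℤ) => Real.pi / 2) δ))
              (CurveClass.rangeSubset (closure D'.carrier)))
            (𝓝[>] (0 : ℝ)) (𝓝 (ENNReal.ofReal (d ^ ((5 : ℝ) / 8)))))
    (hS :
      ∀ (D : DobrushinDomain) (a b : ℝ → MidEdge),
        IsYBEndpointApprox (fun (_ : ℤ) => Real.pi / 2) D a b →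
        ∀ (s : ℕ → ℝ) (ν : Measure (CurveClass ℂ)), Tendsto s atTop (𝓝[>] (0 : ℝ)) →
          IsProbabilityMeasure ν →
          (∀ f : BoundedContinuousFunction (CurveClass ℂ) ℝ,
            Tendsto (fun n => ∫ γ, f (γ.curve (fun (_ : ℤ) => Real.pi / 2) (s n))
                ∂(ybLaw (fun (_ : ℤ) => Real.pi / 2) D.carrier (s n) 1 (a (s n)) (b (s n))))
              atTop (𝓝 (∫ x, f x ∂ν))) →
          ∀ᵐ γ ∂ν, γ ∈ CurveClass.simple) :
    ∀ (D : DobrushinDomain) (a b : ℝ → MidEdge),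
      IsYBEndpointApprox (fun (_ : ℤ) => Real.pi / 2) D a b →
      ∀ μ : Measure (CurveClass ℂ), IsProbabilityMeasure μ →
        IsSubseqLimitLaw
          (fun δ (γ : YangBaxterSAW (fun (_ : ℤ) => Real.pi / 2) D.carrier δ (a δ) (b δ)) =>
            γ.curve (fun (_ : ℤ) => Real.pi / 2) δ)
          (fun δ => ybLaw (fun (_ : ℤ) => Real.pi / 2) D.carrier δ 1 (a δ) (b δ)) μ →
        IsSLELaw ((8 : NNReal) / 3) D μ := by
  intro D a b hab ν hν hsub
  obtain ⟨s, hs, hlim⟩ := hsub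
  classical
  -- the chordal SLE(8/3) law `μ` of `(D; a, b)` and its carrier
  obtain ⟨μ, hμ⟩ : ∃ μ : Measure (CurveClass ℂ), IsSLELaw ((8 : ℝ≥0) / 3) D μ := by
    obtain ⟨Γ, hΓ⟩ := exists_isSLECurve_eightThirds D
    exact ⟨_, hΓ.isSLELaw_map⟩
  obtain ⟨hμP, hμcar⟩ :=
    _root_.Summit.CriticalPhenomena.SAWScalingLimit.Theorems.SLECarrier_proof D μ hμ
  haveI : IsProbabilityMeasure ν := hν
  -- a chordal uniformizing map
  obtain ⟨φ, hφ⟩ := MarkedDomain.exists_isChordalUniformizing_holds D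
  -- along `s`, the lattice avoidance probability of every hull subdomain tends to its SLE(8/3) value
  have hconv : ∀ D' : DobrushinDomain, D'.carrier ⊆ D.carrier → D'.pt 0 = D.pt 0 → D'.pt 1 = D.pt 1 →
      (∃ ε : ℝ, 0 < ε ∧ D'.carrier ∩ Metric.ball (D.pt 0) ε = D.carrier ∩ Metric.ball (D.pt 0) ε ∧
        D'.carrier ∩ Metric.ball (D.pt 1) ε = D.carrier ∩ Metric.ball (D.pt 1) ε) →
      Tendsto (fun n => ((ybLaw (fun (_ : ℤ) => Real.pi / 2) D.carrier (s n) 1 (a (s n)) (b (s n))).map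
          (fun γ => γ.curve (fun (_ : ℤ) => Real.pi / 2) (s n)))
          (CurveClass.rangeSubset (closure D'.carrier)))
        atTop (𝓝 (μ (CurveClass.rangeSubset (closure D'.carrier)))) := by
    intro D' hsub' h0 h1 hε
    have hHull : D.IsHullSubdomain D' :=
      _root_.Summit.CriticalPhenomena.SAWScalingLimit.Theorems.IsingBoundaryRatio.Negative.isHullSubdomain_of_conds
        hsub' h0 h1 hε
    have hA : IsStarHull (φ.pullbackHull D') :=
      IsStarHull.pullbackHull JordanDomain.isSimplyConnected_holds hφ hHull
    obtain ⟨Φ, hΦ⟩ := hA.exists_isRestrictionMap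
    obtain ⟨d, -, -, hd⟩ := IsStarHull.exists_hasRestrictionDeriv_holds hA hΦ
    have hlat := hR D D' a b hab hsub' h0 h1 hε φ hφ Φ d hΦ hd
    have hval : μ (CurveClass.rangeSubset (closure D'.carrier)) = ENNReal.ofReal (d ^ ((5 : ℝ) / 8)) :=
      _root_.Summit.CriticalPhenomena.SAWScalingLimit.Theorems.SLEAvoidanceValue_pullbackHull_proof
        D D' μ hμ hsub' h0 h1 hε φ hφ Φ d hΦ hd
    rw [hval]
    exact hlat.comp hs
  -- I3 (landed): `ν` and `μ` agree on every hull-avoidance event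
  have hagree := stub_ybAvoidancePassage D a b hab s ν μ hs hν hlim hμ hconv
  -- the carrier of `ν`: chordal (I2a, landed), boundary-avoiding (lattice-free), simple (I2b)
  have hsoft : ∀ᵐ γ ∂ν, γ.source = D.pt 0 ∧ γ.target = D.pt 1 ∧ γ.range ⊆ closure D.carrier :=
    stub_ybSubseqLimitChordal D a b hab s ν hs hν hlim
  have hfr : ∀ᵐ γ ∂ν, γ.range ∩ frontier D.carrier ⊆ {D.pt 0, D.pt 1} :=
    _root_.Summit.CriticalPhenomena.SAWScalingLimit.Theorems.SimpleSubseqLimits.MarkedPointRevisit.ArcRangeBoundary.stub_rangeIsArc_boundary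
      D ν μ hν hμP hsoft hμcar hagree
  have hsimple : ∀ᵐ γ ∂ν, γ ∈ CurveClass.simple := hS D a b hab s ν hs hν hlim
  have hνcar : ∀ᵐ γ ∂ν, γ ∈ CurveClass.simple ∧ γ.source = D.pt 0 ∧ γ.target = D.pt 1 ∧
      γ.range ⊆ closure D.carrier ∧ γ.range ∩ frontier D.carrier ⊆ {D.pt 0, D.pt 1} := by
    filter_upwards [hsimple, hsoft, hfr] with γ h1 h2 h3
    exact ⟨h1, h2.1, h2.2.1, h2.2.2, h3⟩
  -- avoidance determines the law: `ν = μ`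
  have heq : ν = μ :=
    _root_.Summit.CriticalPhenomena.SAWScalingLimit.Theorems.AvoidanceDeterminesLaw.AvoidanceDeterminesLaw_proof
      D ν μ hν hμP hνcar hμcar hagree
  rw [heq]
  exact hμ

/-- **`CompassSLE` from the three named open inputs T1 (AB multi-traversal bound), I1 (`5/8`
restriction law), I2b (simplicity of subsequential limits)** for Glazman–Manolescu's critical `π/2`
Yang–Baxter walk — everything else (tightness criterion T2, chordality I2a, avoidance passage I3, the soft
criterion C, the port transfer and dictionary, the SLE(8/3) side of the LSW programme) is a landed
theorem. Registered sub-goal stub `compassSLE_of_traversalBound_restrictionLaw_simpleLimits`. -/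
theorem compassSLE_of_traversalBound_restrictionLaw_simpleLimits :
    (∀ (D : DobrushinDomain) (a b : ℝ → MidEdge),
      IsYBEndpointApprox (fun (_ : ℤ) => Real.pi / 2) D a b →
      ∃ (k : ℂ → ℝ → ℝ → ℕ) (K lam δ₀ : ℝ), 0 ≤ K ∧ 2 < lam ∧ 0 < δ₀ ∧
        ∀ δ ∈ Set.Ioc (0 : ℝ) δ₀, ∀ (x : ℂ) (ρ R : ℝ), δ ≤ ρ → ρ < R → R ≤ 1 →
          ybLaw (fun (_ : ℤ) => Real.pi / 2) D.carrier δ 1 (a δ) (b δ)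
              {γ | (⟨γ.path (fun (_ : ℤ) => Real.pi / 2) δ⟩ : Curve ℂ).HasTraversals (k x ρ R) x ρ R} ≤
            ENNReal.ofReal (K * (ρ / R) ^ lam)) →
    (∀ (D D' : DobrushinDomain) (a b : ℝ → MidEdge),
      IsYBEndpointApprox (fun (_ : ℤ) => Real.pi / 2) D a b →
      D'.carrier ⊆ D.carrier → D'.pt 0 = D.pt 0 → D'.pt 1 = D.pt 1 →
      (∃ ε : ℝ, 0 < ε ∧ D'.carrier ∩ Metric.ball (D.pt 0) ε = D.carrier ∩ Metric.ball (D.pt 0) ε ∧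
        D'.carrier ∩ Metric.ball (D.pt 1) ε = D.carrier ∩ Metric.ball (D.pt 1) ε) →
      ∀ (φ : ConformalEquiv upperHalfPlaneSet D.carrier), D.IsChordalUniformizing φ →
      ∀ (Φ : ConformalEquiv (upperHalfPlaneSet \ φ.pullbackHull D') upperHalfPlaneSet) (d : ℝ),
        IsRestrictionMap (φ.pullbackHull D') Φ → HasRestrictionDeriv (φ.pullbackHull D') Φ d →
        Tendsto (fun δ => ((ybLaw (fun (_ : ℤ) => Real.pi / 2) D.carrier δ 1 (a δ) (b δ)).map
            (fun γ => γ.curve (fun (_ : ℤ) => Real.pi / 2) δ))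
            (CurveClass.rangeSubset (closure D'.carrier)))
          (𝓝[>] (0 : ℝ)) (𝓝 (ENNReal.ofReal (d ^ ((5 : ℝ) / 8))))) →
    (∀ (D : DobrushinDomain) (a b : ℝ → MidEdge),
      IsYBEndpointApprox (fun (_ : ℤ) => Real.pi / 2) D a b →
      ∀ (s : ℕ → ℝ) (ν : Measure (CurveClass ℂ)), Tendsto s atTop (𝓝[>] (0 : ℝ)) →
        IsProbabilityMeasure ν →
        (∀ f : BoundedContinuousFunction (CurveClass ℂ) ℝ,
          Tendsto (fun n => ∫ γ, f (γ.curve (fun (_ : ℤ) => Real.pi / 2) (s n))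
              ∂(ybLaw (fun (_ : ℤ) => Real.pi / 2) D.carrier (s n) 1 (a (s n)) (b (s n))))
            atTop (𝓝 (∫ x, f x ∂ν))) →
        ∀ᵐ γ ∂ν, γ ∈ CurveClass.simple) →
    SAWCompassLattice.CompassSLE := by
  intro hT hR hS
  refine Summit.CriticalPhenomena.SAWScalingLimit.Cruxes.HexTransfer.Sketch.stub_portTransfer
    Summit.CriticalPhenomena.SAWScalingLimit.Cruxes.HexTransfer.Sketch.stub_portDictionary ?_
  intro D a b hab
  exact stub_ybCriterion D a b hab (stub_ybTightOfTraversalBound D a b hab (hT D a b hab))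
    (ybSubseqIdentification_of_restrictionLaw_of_simple hR hS D a b hab)

end Summit.CriticalPhenomena.SAWScalingLimit.Theorems.SAWCompassLatticeCompassSLE

end
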